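import Literature.AnabelianGeometry.AbsoluteAnabelian.ArchimedeanReconstructionAutHolWitness

/-!
# W-F10-6, general form: `NFCurveData.ReconstructsAutHol` fails for EVERY two-point datum with a pole everywhere

Proof-only sibling (abc-iut L4-lead RULINGS #3f (1) / #3i) of the kernel witness
`ArchimedeanReconstruction.AutHolWitness.exists_not_reconstructsAutHol` (p417599, abc-iut-w5-d011): the same F10-6
mechanism stated PARAMETRICALLY — for ANY `D : NFCurveData` with exactly two NF-points, one NF-rational function
and `eval ≡ none`, `X^top` is a two-point indiscrete space, no connected open carries a chart, and `U ↦ ⊥`,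
`U ↦ ⊤` are distinct reconstructed structures, so the typed `∃!` fails.  About OUR typed form of [AbsTopIII]
Cor 2.8 only (charted reading: `NFCurveData.ReconstructsAutHolOnCharts`); no side taken on [IUTchIII] Cor. 3.12.
[cite: MochizukiAbsTopIII2015, Corollary 2.8 pp.63–64]
-/

namespace Literature.AnabelianGeometry.AbsoluteAnabelian.ArchimedeanReconstruction.AutHolWitnessGeneral

open _root_.Filter _root_.Topology _root_.Set _root_.TopologicalSpace

variable (D : NFCurveData) (hev : ∀ (f : D.Fn) (x : D.Pt), D.eval f x = none) (f₀ : D.Fn) (a b : D.Pt)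
  (hab : a ≠ b) (h2 : ∀ z : D.Pt, z = a ∨ z = b)

include hev in
/-- With a pole everywhere, `PolesAvoid f S ↔ S = ∅`. [cite: MochizukiAbsTopIII2015, Corollary 2.8 (a) p.63] -/
theorem polesAvoid_iff (f : D.Fn) (S : Finset D.Pt) : D.PolesAvoid f S ↔ S = ∅ :=
  ⟨fun h => Finset.eq_empty_of_forall_notMem fun x hx => h x hx (hev f x), by rintro rfl x hx; simp at hx⟩

include hev in
/-- With a pole everywhere every `N(U,f)` is empty, so every open of `X^top` is `∅` or `univ`.
[cite: MochizukiAbsTopIII2015, Corollary 2.8 (a) p.63] -/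
theorem eq_empty_or_eq_univ (s : Set D.Xtop) (hs : IsOpen s) : s = ∅ ∨ s = univ := by
  have htop : (⊤ : TopologicalSpace D.Xtop) ≤ D.topXtop := by
    rw [NFCurveData.topXtop, le_generateFrom_iff_subset_isOpen]
    rintro W ⟨U, f, -, rfl⟩
    have : D.N U f = ∅ := Set.eq_empty_of_forall_notMem fun x hx => by
      obtain ⟨j, hj⟩ := hx.1.exists
      exact hj (hev f (x.1 j))
    rw [this, image_empty]
    exact @isOpen_empty _ ⊤
  exact (TopologicalSpace.isOpen_top_iff s).1 (htop s hs)

include hev in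
/-- A sequence eventually avoiding `c` is Cauchy with conductor `{c}`. [cite: MochizukiAbsTopIII2015, Corollary 2.8 (a) p.63] -/
theorem isCauchyWith_singleton {x : ℕ → D.Pt} {c : D.Pt} (hx : ∀ᶠ j in atTop, x j ≠ c) :
    D.IsCauchyWith x {c} where
  eventually_not_mem := by simpa using hx
  eventually_finite f hf := by simpa using (polesAvoid_iff D hev f {c}).1 hf
  cauchy f hf := by simpa using (polesAvoid_iff D hev f {c}).1 hf

include hev f₀ hab h2 in
/-- INVARIANT: with `Pt = {a, b}`, `CauchyEquiv`-related sequences are eventually `a` simultaneously.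
[cite: MochizukiAbsTopIII2015, Corollary 2.8 (a) p.63] -/
theorem evA_iff_of_cauchyEquiv {x y : ℕ → D.Pt} (hxy : D.CauchyEquiv x y) :
    (∀ᶠ j in atTop, x j = a) ↔ (∀ᶠ j in atTop, y j = a) := by
  obtain ⟨S, hxS, hyS, -⟩ := hxy
  have hS : S.Nonempty := Finset.nonempty_iff_ne_empty.2 fun hS => by
    obtain ⟨j, hj⟩ := (hxS.eventually_finite f₀ ((polesAvoid_iff D hev f₀ S).2 hS)).exists
    exact hj (hev f₀ (x j))
  by_cases ha : a ∈ S
  · have key : ∀ {z : ℕ → D.Pt}, D.IsCauchyWith z S → ¬ ∀ᶠ j in atTop, z j = a := fun {z} hz h => by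
      obtain ⟨j, hj⟩ := (h.and hz.eventually_not_mem).exists
      exact hj.2 (by rw [hj.1]; exact ha)
    exact ⟨fun h => (key hxS h).elim, fun h => (key hyS h).elim⟩
  · obtain ⟨c, hc⟩ := hS
    have hb : b ∈ S := by rcases h2 c with rfl | rfl; exacts [(ha hc).elim, hc]
    have key : ∀ {z : ℕ → D.Pt}, D.IsCauchyWith z S → ∀ᶠ j in atTop, z j = a := fun {z} hz =>
      hz.eventually_not_mem.mono fun j hj => by
        rcases h2 (z j) with h | h; exacts [h, (hj (by rw [h]; exact hb)).elim]
    exact ⟨fun _ => key hyS, fun _ => key hxS⟩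

include hev f₀ hab h2 in
/-- The classes of the constant sequences at `a` and at `b` are distinct points of `X^top`.
[cite: MochizukiAbsTopIII2015, Corollary 2.8 (a) p.63] -/
theorem mk_const_ne :
    (Quot.mk _ ⟨fun _ => a, {b}, isCauchyWith_singleton D hev (Eventually.of_forall fun _ => hab)⟩ :
      D.Xtop) ≠ Quot.mk _ ⟨fun _ => b, {a}, isCauchyWith_singleton D hev
        (Eventually.of_forall fun _ => Ne.symm hab)⟩ := by
  intro h
  suffices key : ∀ {x y : {x : ℕ → D.Pt // D.IsCauchy x}}, Relation.EqvGen
      (fun x y : {x : ℕ → D.Pt // D.IsCauchy x} => D.CauchyEquiv x.1 y.1) x y →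
      ((∀ᶠ j in atTop, x.1 j = a) ↔ ∀ᶠ j in atTop, y.1 j = a) by
    obtain ⟨j, hj⟩ := ((key (Quot.eqvGen_exact h)).1 (Eventually.of_forall fun _ => rfl)).exists
    exact hab hj.symm
  intro x y hxy
  induction hxy with
  | rel u v huv => exact evA_iff_of_cauchyEquiv D hev f₀ a b hab h2 huv
  | refl u => exact Iff.rfl
  | symm u v _ ih => exact ih.symm
  | trans u v w _ _ ih₁ ih₂ => exact ih₁.trans ih₂

include hev f₀ hab h2 in
/-- NO CHARTS on any connected open (the chart function would be `0` at both points); hence EVERY `A` is a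
reconstructed structure. [cite: MochizukiAbsTopIII2015, Corollary 2.8 (b) p.64] -/
theorem isReconstructedStructure (A : AutHolStructure D.Xtop) : D.IsReconstructedStructure A := by
  intro UX c _
  exfalso
  have hmem : ∀ z : D.Xtop, z ∈ (UX.1 : Opens D.Xtop) := fun z => by
    show z ∈ ((UX.1 : Opens D.Xtop) : Set D.Xtop)
    rcases eq_empty_or_eq_univ D hev _ UX.1.isOpen with h | h
    · exact absurd h UX.2.nonempty.ne_empty
    · rw [h]; exact mem_univ z
  have h0 : ∀ x : {x : ℕ → D.Pt // D.IsCauchy x}, ((c.fU ⟨Quot.mk _ x, hmem _⟩ : c.Uv) : D.kv) = 0 :=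
    fun x => by
    have h := c.fU_spec x (hmem _)
    simp only [NFCurveData.valv, hev, Option.map_none, Option.getD_none] at h
    exact tendsto_nhds_unique h tendsto_const_nhds
  exact mk_const_ne D hev f₀ a b hab h2 (congrArg Subtype.val
    (c.fU.injective (Subtype.ext ((h0 _).trans (h0 _).symm))))

include hev f₀ hab h2 in
/-- **General W-F10-6**: `U ↦ ⊥` and `U ↦ ⊤` are distinct reconstructed structures (they differ at the
connected open `⊤`, whose homeomorphism group contains the transposition of the two points), so the typed
`∃!` fails. [cite: MochizukiAbsTopIII2015, Corollary 2.8 pp.63–64] -/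
theorem not_reconstructsAutHol : ¬ D.ReconstructsAutHol := by
  classical
  have hpq := mk_const_ne D hev f₀ a b hab h2
  set p : D.Xtop := Quot.mk _ ⟨fun _ => a, {b}, isCauchyWith_singleton D hev
    (Eventually.of_forall fun _ => hab)⟩
  set q : D.Xtop := Quot.mk _ ⟨fun _ => b, {a}, isCauchyWith_singleton D hev
    (Eventually.of_forall fun _ => Ne.symm hab)⟩
  have hcont : ∀ g : D.Xtop → D.Xtop, Continuous g := fun g => continuous_def.2 fun s hs => by
    rcases eq_empty_or_eq_univ D hev s hs with rfl | rfl; exacts [isOpen_empty, isOpen_univ]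
  have hconn : IsConnected (((⊤ : Opens D.Xtop)) : Set D.Xtop) := by
    refine ⟨⟨p, trivial⟩, ?_⟩
    rintro u v hu hv - ⟨s, -, hsu⟩ ⟨t, -, htv⟩
    rcases eq_empty_or_eq_univ D hev u hu with rfl | rfl; · exact absurd hsu (notMem_empty s)
    rcases eq_empty_or_eq_univ D hev v hv with rfl | rfl; · exact absurd htv (notMem_empty t)
    exact ⟨s, trivial, mem_univ s, mem_univ s⟩
  let σ : D.Xtop ≃ₜ D.Xtop :=
    { toEquiv := Equiv.swap p q, continuous_toFun := hcont _, continuous_invFun := hcont _ }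
  let τ : ((⊤ : Opens D.Xtop)) ≃ₜ ((⊤ : Opens D.Xtop)) :=
    { toFun := fun x => ⟨σ x.1, trivial⟩, invFun := fun x => ⟨σ.symm x.1, trivial⟩,
      left_inv := fun x => Subtype.ext (σ.symm_apply_apply x.1),
      right_inv := fun x => Subtype.ext (σ.apply_symm_apply x.1),
      continuous_toFun := (σ.continuous.comp continuous_subtype_val).subtype_mk _,
      continuous_invFun := (σ.symm.continuous.comp continuous_subtype_val).subtype_mk _ }
  rintro ⟨A, -, huniq⟩
  have h := congrArg (fun B : AutHolStructure D.Xtop => B.aut ⟨⊤, hconn⟩)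
    ((huniq ⟨fun _ => ⊥⟩ (isReconstructedStructure D hev f₀ a b hab h2 _)).trans
      (huniq ⟨fun _ => ⊤⟩ (isReconstructedStructure D hev f₀ a b hab h2 _)).symm)
  have hτ : τ ∈ (⊥ : Subgroup (((⊤ : Opens D.Xtop)) ≃ₜ ((⊤ : Opens D.Xtop)))) := by
    simp only at h; rw [h]; exact Subgroup.mem_top τ
  rw [Subgroup.mem_bot] at hτ
  have h1 : (τ ⟨p, trivial⟩ : (⊤ : Opens D.Xtop)).1 = q := Equiv.swap_apply_left p q
  rw [hτ] at h1
  exact hpq h1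

end Literature.AnabelianGeometry.AbsoluteAnabelian.ArchimedeanReconstruction.AutHolWitnessGeneral
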